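import Literature.RepresentationTheory.KonnoKonno2007.RealUnitaryRankOneKAK
import Literature.RepresentationTheory.BorelWallach2000.UpqMaximalCompactBlocks
import Literature.RepresentationTheory.BorelWallach2000.UpqLefschetzDecomposition
import Mathlib.Analysis.SpecialFunctions.Exponential
import Mathlib.Analysis.SpecialFunctions.Trigonometric.DerivHyp
import Mathlib.Analysis.Calculus.LocalExtr.Basic
import Mathlib.Analysis.SpecialFunctions.ExpDeriv
import HarnessLib

/-!
# Fibres of the `KAK` map of the rank-one unitary group `U(α,β)`, `|β| = 1`: the boost generator, the fibre lemma,
# `K`-transitivity on `𝔭`, and «at most one point of `g·A` lies in `K`»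

Topic `RepresentationTheory/KonnoKonno2007`; namespace `Literature.RepresentationTheory.KonnoKonno2007.RealDualPair` (sequel of ★
`RealUnitaryRankOneKAK`: `hypV p₀ q₀ t = a_t`, `kakMap (k₁, t, k₂) = k₁ a_t k₂`, `gauge`, `weylKV`, surjectivity∕properness∕quotient map).
THEOREMS ONLY (no definition, no instance, no notation, no named fact, no `sorry`).  Cell `hodgecm-mathlib`, F0∕P3, the in-house road to the
letter A6 `HasUnitaryGlobalizationOfInfUnitary` at `U(2,1)` (ROAD-GLOB v1.1, brick S1a): the unitary globalization `Φ` of an admissible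
`(𝔤, K)`-module is DEFINED on `K × ℝ × K` by `(k₁, t, k₂) ↦ ϖK(k₁) ∘ U_{H₀}(t) ∘ ϖK(k₂)` and must be constant on the fibres of `kakMap`; this
file supplies exactly the group-side facts that makes that (and the later ODE along `s ↦ g · a_s`) work.

* §1 **the boost generator** `H₀ := upqUnit (p₀, q₀) (−i) ∈ 𝔭 ⊂ 𝔲(α, β)` (★ `upqUnit`; matrix `−i E_{p₀q₀} + i E_{q₀p₀}`) and
  **`exp (t H₀) = a_t`** (`exp_smul_boostUnit`, `expMem_smul_boostUnit`; generic `α`, `β`, by the ODE `a_t' = a_t H₀`, `a_0 = 1`: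
  `hasDerivAt_coe_hypV`), [Knapp2002, I §10 Prop. 1.87].
* §2 **the fibre lemma** (`|β| = 1`): if `k₁ a_t k₂ = k₁' a_{t'} k₂'` with `t, t' ≥ 0` then `t = t'` (`eq_of_kakMap_eq_of_nonneg`, through ★
  `gauge_kakMap`); if moreover `t > 0` then `m := k₁⁻¹ k₁' = k₂ k₂'⁻¹` (`kV_inv_mul_eq_mul_inv_of_kakMap_eq`) and `m` COMMUTES WITH `H₀`
  (`kV_mul_boostUnit_comm_of_kakMap_eq`) — the centraliser statement `Z_K(A) = M`, [Knapp2002, VII §3 (7.32)–(7.33), Thm. 7.39].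
* §3 **`K` is transitive on the directions of `𝔭`**: every hermitian `X ∈ 𝔲(α, β)` is `Ad k (c • H₀)` with `k ∈ K`, `c ≥ 0`
  (`exists_Ad_smul_boostUnit_eq_of_isHermitian`), [Knapp2002, Thm. 6.51 (`𝔭 = Ad(K) 𝔞`) for real rank one].
* §4 **at most one point of the curve `s ↦ g · a_s` lies in `K`** (`subsingleton_setOf_mul_hypV_mem_range_kV`): the gauge
  `s ↦ ‖(g a_s)_{q₀q₀}‖² = |A|²e^{2s} + |B|²e^{−2s} + 2 Re(A B̄)` is `≥ 1` on `U(α,β)` and has at most one critical point; with the membership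
  criterion `gauge = 1 ⇔ ∈ K` (`exists_kV_eq_of_gauge_eq_one`, `one_le_gauge`).

## Mathlib ∕ tree search
Tree: ★ `RealUnitaryRankOneKAK` (all of §2–§8 there), ★ `upqUnit`∕`coe_upqUnit` (`UpqLefschetzDecomposition`), ★ `upq_Ad_offDiag`,
`upqMaximalCompactEquiv`, `coe_eq_fromBlocks_upqKBlock` (`UpqMaximalCompactBlocks`), ★ `exists_unitaryGroup_col_eq`, `exists_eq_kV_of_col_eq`,
`UForm.form_apply`.  Mathlib: `hasDerivAt_exp_smul_const'`, `is_const_of_deriv_eq_zero`, `Matrix.exp_add_of_commute`, `Real.hasDerivAt_sinh∕cosh`,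
`IsLocalMin.hasDerivAt_eq_zero`, `Real.exp_eq_exp`.  Dedup: `rg "boostUnit|kakMap_eq|gauge_eq_one" Literature/` — no hits.

## References
* [Knapp2002] A. W. Knapp, *Lie Groups Beyond an Introduction*, 2nd ed. (2002), I §10, VI §5 Thm. 6.51, VII §3 Thm. 7.39.
* [Helgason1978] S. Helgason, *Differential Geometry, Lie Groups, and Symmetric Spaces*, Ch. IX §1.
-/

set_option autoImplicit false

noncomputable section

open Matrix Complex Topology Filter
open scoped ComplexConjugate MatrixGroups
open NormedSpace -- `exp`

namespace Literature.RepresentationTheory.KonnoKonno2007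

namespace RealDualPair

open Literature.NumberTheory.Automorphic Literature.RepresentationTheory.BorelWallach2000
open Literature.RepresentationTheory.KonnoKonno2007.RealDualPair.UForm

variable {α β : Type*} [Fintype α] [DecidableEq α] [Fintype β] [DecidableEq β] (p₀ : α) (q₀ : β)

/-! ## §1 The boost generator `H₀ = upqUnit (p₀, q₀) (−i)` and `exp (t H₀) = a_t` -/

section Boost

/-- The matrix of the boost generator `H₀ = upqUnit (p₀, q₀) (−i)`: `[[0, −i E_{p₀q₀}], [i E_{q₀p₀}, 0]]`. [cite: Knapp2002, I §10] -/
theorem coe_boostUnit :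
    ((upqUnit (p₀, q₀) (-I) : (uFormGroup α β).lie) : Matrix (α ⊕ β) (α ⊕ β) ℂ) =
      Matrix.fromBlocks 0 (Matrix.single p₀ q₀ (-I)) (Matrix.single q₀ p₀ I) 0 := by
  rw [coe_upqUnit]
  congr 1
  ext i j
  simp only [Matrix.conjTranspose_apply, Matrix.single_apply]
  by_cases h : q₀ = i ∧ p₀ = j
  · rw [if_pos ⟨h.2, h.1⟩, if_pos h, star_neg, Complex.star_def, Complex.conj_I, neg_neg]
  · rw [if_neg (fun h' => h ⟨h'.2, h'.1⟩), if_neg h, star_zero]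

/-- Entries of `H₀`, block `(α, α)`: zero. [cite: Knapp2002, I §10] -/
theorem boostUnit_inl_inl (a a' : α) :
    ((upqUnit (p₀, q₀) (-I) : (uFormGroup α β).lie) : Matrix (α ⊕ β) (α ⊕ β) ℂ) (Sum.inl a) (Sum.inl a') = 0 := by
  rw [coe_boostUnit, Matrix.fromBlocks_apply₁₁, Matrix.zero_apply]

/-- Entries of `H₀`, block `(β, β)`: zero. [cite: Knapp2002, I §10] -/
theorem boostUnit_inr_inr (b b' : β) :
    ((upqUnit (p₀, q₀) (-I) : (uFormGroup α β).lie) : Matrix (α ⊕ β) (α ⊕ β) ℂ) (Sum.inr b) (Sum.inr b') = 0 := by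
  rw [coe_boostUnit, Matrix.fromBlocks_apply₂₂, Matrix.zero_apply]

/-- Entries of `H₀`, block `(α, β)`: `−i` at `(p₀, q₀)`. [cite: Knapp2002, I §10] -/
theorem boostUnit_inl_inr (a : α) (b : β) :
    ((upqUnit (p₀, q₀) (-I) : (uFormGroup α β).lie) : Matrix (α ⊕ β) (α ⊕ β) ℂ) (Sum.inl a) (Sum.inr b) =
      if a = p₀ ∧ b = q₀ then -I else 0 := by
  rw [coe_boostUnit, Matrix.fromBlocks_apply₁₂, Matrix.single_apply]
  by_cases h : a = p₀ ∧ b = q₀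
  · rw [if_pos h, if_pos ⟨h.1.symm, h.2.symm⟩]
  · rw [if_neg h, if_neg fun h' => h ⟨h'.1.symm, h'.2.symm⟩]

/-- Entries of `H₀`, block `(β, α)`: `i` at `(q₀, p₀)`. [cite: Knapp2002, I §10] -/
theorem boostUnit_inr_inl (b : β) (a : α) :
    ((upqUnit (p₀, q₀) (-I) : (uFormGroup α β).lie) : Matrix (α ⊕ β) (α ⊕ β) ℂ) (Sum.inr b) (Sum.inl a) =
      if b = q₀ ∧ a = p₀ then I else 0 := by
  rw [coe_boostUnit, Matrix.fromBlocks_apply₂₁, Matrix.single_apply]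
  by_cases h : b = q₀ ∧ a = p₀
  · rw [if_pos h, if_pos ⟨h.1.symm, h.2.symm⟩]
  · rw [if_neg h, if_neg fun h' => h ⟨h'.1.symm, h'.2.symm⟩]

/-- `H₀` is hermitian (it lies in `𝔭`). [cite: Knapp2002, VI §2] -/
theorem conjTranspose_boostUnit :
    (((upqUnit (p₀, q₀) (-I) : (uFormGroup α β).lie) : Matrix (α ⊕ β) (α ⊕ β) ℂ))ᴴ =
      ((upqUnit (p₀, q₀) (-I) : (uFormGroup α β).lie) : Matrix (α ⊕ β) (α ⊕ β) ℂ) := by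
  rw [coe_boostUnit, Matrix.fromBlocks_conjTranspose, Matrix.conjTranspose_zero, Matrix.conjTranspose_zero,
    Matrix.conjTranspose_single, Matrix.conjTranspose_single]
  simp only [Complex.star_def, map_neg, Complex.conj_I, neg_neg]

/-- **The product `a_t · H₀` by entries** — it is the entrywise derivative of `a_t`: `sinh t` at `(p₀,p₀)` and `(q₀,q₀)`, `−i cosh t` at
`(p₀, q₀)`, `i cosh t` at `(q₀, p₀)`, zero elsewhere. [cite: Knapp2002, I §10] -/
theorem coe_hypV_mul_boostUnit_apply (t : ℝ) (i j : α ⊕ β) :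
    ((((hypV p₀ q₀ t : UForm α β) : GL (α ⊕ β) ℂ) : Matrix (α ⊕ β) (α ⊕ β) ℂ) *
        ((upqUnit (p₀, q₀) (-I) : (uFormGroup α β).lie) : Matrix (α ⊕ β) (α ⊕ β) ℂ)) i j =
      match i, j with
      | Sum.inl a, Sum.inl a' => if a = p₀ ∧ a' = p₀ then (Real.sinh t : ℂ) else 0
      | Sum.inl a, Sum.inr b => if a = p₀ ∧ b = q₀ then -(Real.cosh t : ℂ) * I else 0
      | Sum.inr b, Sum.inl a' => if b = q₀ ∧ a' = p₀ then (Real.cosh t : ℂ) * I else 0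
      | Sum.inr b, Sum.inr b' => if b = q₀ ∧ b' = q₀ then (Real.sinh t : ℂ) else 0 := by
  rw [Matrix.mul_apply, Fintype.sum_sum_type]
  rcases i with a | b <;> rcases j with a' | b'
  · -- `(inl a, inl a')`: only `k = inr q₀` contributes
    simp only [boostUnit_inl_inl, mul_zero, Finset.sum_const_zero, zero_add, boostUnit_inr_inl, hypV_inl_inr]
    rw [Finset.sum_eq_single q₀ (fun b _ hb => by simp [hb]) (fun h => absurd (Finset.mem_univ _) h)]
    by_cases ha : a = p₀ <;> by_cases ha' : a' = p₀ <;> simp [ha, ha', mul_assoc, Complex.I_mul_I]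
  · -- `(inl a, inr b')`: only `k = inl p₀` contributes
    simp only [boostUnit_inl_inr, boostUnit_inr_inr, mul_zero, Finset.sum_const_zero, add_zero, hypV_inl_inl]
    rw [Finset.sum_eq_single p₀ (fun a'' _ ha'' => by simp [ha'']) (fun h => absurd (Finset.mem_univ _) h)]
    by_cases ha : a = p₀ <;> by_cases hb : b' = q₀ <;> simp [ha, hb]
    intro h
    exact absurd h.symm ha
  · -- `(inr b, inl a')`: only `k = inr q₀` contributes
    simp only [boostUnit_inl_inl, mul_zero, Finset.sum_const_zero, zero_add, boostUnit_inr_inl, hypV_inr_inr]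
    rw [Finset.sum_eq_single q₀ (fun b'' _ hb'' => by simp [hb'']) (fun h => absurd (Finset.mem_univ _) h)]
    by_cases hb : b = q₀ <;> by_cases ha' : a' = p₀ <;> simp [hb, ha']
    intro h
    exact absurd h.symm hb
  · -- `(inr b, inr b')`: only `k = inl p₀` contributes
    simp only [boostUnit_inl_inr, boostUnit_inr_inr, mul_zero, Finset.sum_const_zero, add_zero, hypV_inr_inl]
    rw [Finset.sum_eq_single p₀ (fun a'' _ ha'' => by simp [ha'']) (fun h => absurd (Finset.mem_univ _) h)]
    by_cases hb : b = q₀ <;> by_cases hb' : b' = q₀ <;> simp [hb, hb', mul_assoc, Complex.I_mul_I]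

/-- **`t ↦ a_t` is differentiable with `a_t' = a_t · H₀`** (as a matrix-valued map). [cite: Knapp2002, I §10 Prop. 1.87] -/
theorem hasDerivAt_coe_hypV (t : ℝ) :
    HasDerivAt (fun s : ℝ => (((hypV p₀ q₀ s : UForm α β) : GL (α ⊕ β) ℂ) : Matrix (α ⊕ β) (α ⊕ β) ℂ))
      ((((hypV p₀ q₀ t : UForm α β) : GL (α ⊕ β) ℂ) : Matrix (α ⊕ β) (α ⊕ β) ℂ) *
        ((upqUnit (p₀, q₀) (-I) : (uFormGroup α β).lie) : Matrix (α ⊕ β) (α ⊕ β) ℂ)) t := by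
  refine hasDerivAt_pi.2 fun i => hasDerivAt_pi.2 fun j => ?_
  rw [coe_hypV_mul_boostUnit_apply]
  have hc : HasDerivAt (fun s : ℝ => (Real.cosh s : ℂ)) (Real.sinh t : ℂ) t := (Real.hasDerivAt_cosh t).ofReal_comp
  have hs : HasDerivAt (fun s : ℝ => (Real.sinh s : ℂ)) (Real.cosh t : ℂ) t := (Real.hasDerivAt_sinh t).ofReal_comp
  rcases i with a | b <;> rcases j with a' | b'
  · simp only [hypV_inl_inl]
    by_cases ha : a = p₀
    · subst ha
      by_cases ha' : a' = a
      · subst ha'; simpa using hc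
      · have ha'' : ¬a = a' := fun h => ha' h.symm
        simpa [ha', ha''] using hasDerivAt_const t (0 : ℂ)
    · by_cases ha' : a' = a
      · simpa [ha, ha'] using hasDerivAt_const t (1 : ℂ)
      · simpa [ha, ha'] using hasDerivAt_const t (0 : ℂ)
  · simp only [hypV_inl_inr]
    by_cases h : a = p₀ ∧ b' = q₀
    · simp only [h, and_self, if_true]
      have := (hs.mul_const I).fun_neg
      simpa [neg_mul] using this
    · simpa [h] using hasDerivAt_const t (0 : ℂ)
  · simp only [hypV_inr_inl]
    by_cases h : b = q₀ ∧ a' = p₀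
    · simp only [h, and_self, if_true]
      exact hs.mul_const I
    · simpa [h] using hasDerivAt_const t (0 : ℂ)
  · simp only [hypV_inr_inr]
    by_cases hb : b = q₀
    · subst hb
      by_cases hb' : b' = b
      · subst hb'; simpa using hc
      · have hb'' : ¬b = b' := fun h => hb' h.symm
        simpa [hb', hb''] using hasDerivAt_const t (0 : ℂ)
    · by_cases hb' : b' = b
      · simpa [hb, hb'] using hasDerivAt_const t (1 : ℂ)
      · simpa [hb, hb'] using hasDerivAt_const t (0 : ℂ)

end Boost

/-! ### The exponential formula `exp (t H₀) = a_t` (ODE proof, entrywise; generic `α`, `β`) -/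

section ExpFormula

-- The scoped `L^∞`-operator normed algebra structure on matrices (`open scoped Matrix.Norms.Operator in`, as in
-- `Mathlib/Analysis/Normed/Algebra/MatrixExponential.lean` and ★ `JunctionLinearRealGroup`) is used only to differentiate `u ↦ exp (u • X)` and for
-- `Commute.exp_right`; all exported statements are norm-free.
set_option backward.isDefEq.respectTransparency false in
open scoped Matrix.Norms.Operator in
/-- Entrywise derivative of `t ↦ exp (t X)` (real parameter): `d/dt (e^{tX})_{jk} = (e^{tX} X)_{jk}`. [cite: Knapp2002, I §10 Prop. 1.87] -/
theorem hasDerivAt_exp_ofReal_smul_entry {n : Type*} [Fintype n] [DecidableEq n] (X : Matrix n n ℂ) (t₀ : ℝ) (j k : n) :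
    HasDerivAt (fun t : ℝ => exp ((t : ℂ) • X) j k) ((exp ((t₀ : ℂ) • X) * X) j k) t₀ := by
  have h : HasDerivAt (fun u : ℂ => exp (u • X)) (exp ((t₀ : ℂ) • X) * X) (t₀ : ℂ) := hasDerivAt_exp_smul_const X (t₀ : ℂ)
  let L : Matrix n n ℂ →L[ℂ] ℂ := LinearMap.toContinuousLinearMap (Matrix.entryLinearMap ℂ ℂ j k)
  exact (L.hasFDerivAt.comp_hasDerivAt (t₀ : ℂ) h).comp_ofReal

/-- Real scalars act on complex matrices through `ℝ → ℂ`: `(t : ℂ) • X = t • X`. [cite: Knapp2002, I §1 Example (3), VII §3 Thm. 7.39] -/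
theorem ofReal_smul_matrix {m n : Type*} (X : Matrix m n ℂ) (t : ℝ) : ((t : ℂ) • X) = t • X := by
  ext i j
  simp [Matrix.smul_apply, Complex.real_smul]

set_option backward.isDefEq.respectTransparency false in
open scoped Matrix.Norms.Operator in
/-- **`exp (t H₀) = a_t`**: the hyperbolic one-parameter group of ★ `RealUnitaryRankOneKAK` IS the exponential of the boost generator
`H₀ = upqUnit (p₀, q₀) (−i)` (both solve `X' = X H₀`, `X(0) = 1`; compare `t ↦ a_t e^{−tH₀}`, which has zero derivative). (Complex-scalar form.)
[cite: Knapp2002, I §10 Prop. 1.87] -/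
theorem exp_ofReal_smul_boostUnit (t : ℝ) :
    exp ((t : ℂ) • ((upqUnit (p₀, q₀) (-I) : (uFormGroup α β).lie) : Matrix (α ⊕ β) (α ⊕ β) ℂ)) =
      (((hypV p₀ q₀ t : UForm α β) : GL (α ⊕ β) ℂ) : Matrix (α ⊕ β) (α ⊕ β) ℂ) := by
  set H := ((upqUnit (p₀, q₀) (-I) : (uFormGroup α β).lie) : Matrix (α ⊕ β) (α ⊕ β) ℂ) with hH
  set F : ℝ → Matrix (α ⊕ β) (α ⊕ β) ℂ := fun s => (((hypV p₀ q₀ s : UForm α β) : GL (α ⊕ β) ℂ) : Matrix (α ⊕ β) (α ⊕ β) ℂ)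
    with hF
  set E : ℝ → Matrix (α ⊕ β) (α ⊕ β) ℂ := fun s => exp ((((-s : ℝ) : ℂ)) • H) with hE
  -- entrywise derivatives of `F` and `E`
  have hF' : ∀ s j l, HasDerivAt (fun s => F s j l) ((F s * H) j l) s := fun s j l =>
    hasDerivAt_pi.1 (hasDerivAt_pi.1 (hasDerivAt_coe_hypV p₀ q₀ s) j) l
  have hE' : ∀ s l k, HasDerivAt (fun s => E s l k) (-((E s * H) l k)) s := by
    intro s l k
    have h := (hasDerivAt_exp_ofReal_smul_entry H (-s) l k).scomp s (hasDerivAt_neg s)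
    simpa [hE, Function.comp_def] using h
  -- `H` commutes with `E s`
  have hcomm : ∀ s, H * E s = E s * H := fun s => (((Commute.refl H).smul_right (((-s : ℝ) : ℂ))).exp_right).eq
  -- every entry of `s ↦ F s * E s` has zero derivative
  have hG : ∀ j k s, HasDerivAt (fun s => (F s * E s) j k) 0 s := by
    intro j k s
    have hsum : HasDerivAt (fun s => ∑ l, F s j l * E s l k) (∑ l, ((F s * H) j l * E s l k + F s j l * -((E s * H) l k))) s :=
      HasDerivAt.fun_sum fun l _ => (hF' s j l).mul (hE' s l k)
    have hval : ∑ l, ((F s * H) j l * E s l k + F s j l * -((E s * H) l k)) = 0 := by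
      have h1 : ∑ l, (F s * H) j l * E s l k = (F s * H * E s) j k := by rw [Matrix.mul_apply]
      have h2 : ∑ l, F s j l * (E s * H) l k = (F s * (E s * H)) j k := by rw [Matrix.mul_apply]
      simp only [mul_neg, Finset.sum_add_distrib, Finset.sum_neg_distrib, h1, h2, Matrix.mul_assoc, hcomm, add_neg_cancel]
    rw [hval] at hsum
    refine hsum.congr_of_eventuallyEq (Filter.Eventually.of_forall fun s => ?_)
    simp only [Matrix.mul_apply]
  -- hence `F s * E s = F 0 * E 0 = 1`
  have hconst : ∀ s, F s * E s = 1 := by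
    intro s
    have h0 : F 0 * E 0 = 1 := by
      simp only [hF, hE, hypV_zero, UForm.coe_one, neg_zero, Complex.ofReal_zero, zero_smul, NormedSpace.exp_zero, Matrix.mul_one]
    rw [← h0]
    ext j k
    exact is_const_of_deriv_eq_zero (fun s => (hG j k s).differentiableAt) (fun s => (hG j k s).deriv) s 0
  -- and `F t = F t * E t * exp (t H) = exp (t H)`
  have hEt : E t * exp ((t : ℂ) • H) = 1 := by
    rw [hE]
    dsimp only
    rw [← Matrix.exp_add_of_commute _ _ (((Commute.refl H).smul_left _).smul_right _), Complex.ofReal_neg, neg_smul,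
      neg_add_cancel, NormedSpace.exp_zero]
  calc exp ((t : ℂ) • H) = F t * E t * exp ((t : ℂ) • H) := by rw [hconst t, Matrix.one_mul]
    _ = F t := by rw [Matrix.mul_assoc, hEt, Matrix.mul_one]

/-- **`exp (t H₀) = a_t`** (real-scalar form). [cite: Knapp2002, I §10 Prop. 1.87] -/
theorem exp_smul_boostUnit (t : ℝ) :
    exp (t • ((upqUnit (p₀, q₀) (-I) : (uFormGroup α β).lie) : Matrix (α ⊕ β) (α ⊕ β) ℂ)) =
      (((hypV p₀ q₀ t : UForm α β) : GL (α ⊕ β) ℂ) : Matrix (α ⊕ β) (α ⊕ β) ℂ) := by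
  rw [← ofReal_smul_matrix, exp_ofReal_smul_boostUnit]

/-- **`expMem (t • H₀) = a_t` in `U(α,β)`**: the one-parameter subgroup of ★ `RealMatrixGroup.expMem` generated by the boost generator is the
hyperbolic subgroup `hypV p₀ q₀` of ★ `RealUnitaryRankOneKAK`. [cite: Knapp2002, I §10 Prop. 1.87] -/
theorem expMem_smul_boostUnit (t : ℝ) :
    (uFormGroup α β).expMem (t • upqUnit (p₀, q₀) (-I)) = hypV p₀ q₀ t := by
  apply Subtype.ext
  apply Units.ext
  rw [RealMatrixGroup.coe_expMem, coe_expGL]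
  exact exp_smul_boostUnit p₀ q₀ t

end ExpFormula

/-! ## §2 The fibre lemma: `k₁ a_t k₂ = k₁' a_{t'} k₂'`, `t, t' ≥ 0` ⇒ `t = t'`, and for `t > 0` the two triples differ by an element of
`M = Z_K(H₀)` -/

section Fibre

/-- Rows of `diag(P, π) · M` in the `α`-block: `(kV p · M)_{(inl a) j} = Σ_{a''} P_{a a''} M_{(inl a'') j}`. [cite: Knapp2002, I §1 Example (3), VII §3 Thm. 7.39] -/
theorem coe_kV_mul_apply_inl (p : KV α β) (M : Matrix (α ⊕ β) (α ⊕ β) ℂ) (a : α) (j : α ⊕ β) :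
    ((((kV α β p : UForm α β) : GL (α ⊕ β) ℂ) : Matrix (α ⊕ β) (α ⊕ β) ℂ) * M) (Sum.inl a) j =
      ∑ a'', (p.1 : Matrix α α ℂ) a a'' * M (Sum.inl a'') j := by
  rw [Matrix.mul_apply, Fintype.sum_sum_type]
  simp [UForm.coe_kV]

/-- Rows of `diag(P, π) · M` in the `β`-block (`|β| = 1`): `(kV p · M)_{(inr b) j} = π_{bb} M_{(inr b) j}`. [cite: Knapp2002, I §1 Example (3), VII §3 Thm. 7.39] -/
theorem coe_kV_mul_apply_inr [Subsingleton β] (p : KV α β) (M : Matrix (α ⊕ β) (α ⊕ β) ℂ) (b : β) (j : α ⊕ β) :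
    ((((kV α β p : UForm α β) : GL (α ⊕ β) ℂ) : Matrix (α ⊕ β) (α ⊕ β) ℂ) * M) (Sum.inr b) j =
      (p.2 : Matrix β β ℂ) b b * M (Sum.inr b) j := by
  rw [Matrix.mul_apply, Fintype.sum_sum_type]
  simp [UForm.coe_kV, Fintype.sum_subsingleton _ b]

/-- Columns of `M · diag(Q, θ)` in the `α`-block: `(M · kV q)_{i (inl a')} = Σ_{a''} M_{i (inl a'')} Q_{a'' a'}`. [cite: Knapp2002, I §1 Example (3), VII §3 Thm. 7.39] -/
theorem coe_mul_kV_apply_inl (q : KV α β) (M : Matrix (α ⊕ β) (α ⊕ β) ℂ) (i : α ⊕ β) (a' : α) :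
    (M * (((kV α β q : UForm α β) : GL (α ⊕ β) ℂ) : Matrix (α ⊕ β) (α ⊕ β) ℂ)) i (Sum.inl a') =
      ∑ a'', M i (Sum.inl a'') * (q.1 : Matrix α α ℂ) a'' a' := by
  rw [Matrix.mul_apply, Fintype.sum_sum_type]
  simp [UForm.coe_kV]

/-- Columns of `M · diag(Q, θ)` in the `β`-block (`|β| = 1`): `(M · kV q)_{i (inr b')} = M_{i (inr b')} θ_{b'b'}`. [cite: Knapp2002, I §1 Example (3), VII §3 Thm. 7.39] -/
theorem coe_mul_kV_apply_inr [Subsingleton β] (q : KV α β) (M : Matrix (α ⊕ β) (α ⊕ β) ℂ) (i : α ⊕ β) (b' : β) :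
    (M * (((kV α β q : UForm α β) : GL (α ⊕ β) ℂ) : Matrix (α ⊕ β) (α ⊕ β) ℂ)) i (Sum.inr b') =
      M i (Sum.inr b') * (q.2 : Matrix β β ℂ) b' b' := by
  rw [Matrix.mul_apply, Fintype.sum_sum_type]
  simp [UForm.coe_kV, Fintype.sum_subsingleton _ b']

/-- **The centraliser of `a_t` (`t ≠ 0`) in `K × K`** (`|β| = 1`): if `diag(P, π) · a_t = a_t · diag(Q, θ)` then `(P, π) = (Q, θ)`, the `p₀`-column and
`p₀`-row of `P` are `π e_{p₀}`, `π e_{p₀}ᵀ` — so that `diag(P, π)` COMMUTES WITH THE BOOST GENERATOR `H₀`.  This is `Z_K(A) = M` for the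
rank-one group `U(α, β)`. [cite: Knapp2002, VII §3 (7.33), Thm. 7.39] -/
theorem eq_and_commute_of_kV_mul_hypV_eq [Subsingleton β] {p q : KV α β} {t : ℝ} (ht : t ≠ 0)
    (h : kV α β p * hypV p₀ q₀ t = hypV p₀ q₀ t * kV α β q) :
    p = q ∧
      (((kV α β p : UForm α β) : GL (α ⊕ β) ℂ) : Matrix (α ⊕ β) (α ⊕ β) ℂ) *
          ((upqUnit (p₀, q₀) (-I) : (uFormGroup α β).lie) : Matrix (α ⊕ β) (α ⊕ β) ℂ) =
        ((upqUnit (p₀, q₀) (-I) : (uFormGroup α β).lie) : Matrix (α ⊕ β) (α ⊕ β) ℂ) *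
          (((kV α β p : UForm α β) : GL (α ⊕ β) ℂ) : Matrix (α ⊕ β) (α ⊕ β) ℂ) := by
  have hS : (Real.sinh t : ℂ) ≠ 0 := by exact_mod_cast Real.sinh_ne_zero.2 ht
  have hC : (Real.cosh t : ℂ) ≠ 0 := by exact_mod_cast (Real.cosh_pos t).ne'
  have hSI : (Real.sinh t : ℂ) * I ≠ 0 := mul_ne_zero hS Complex.I_ne_zero
  have hSI' : -(Real.sinh t : ℂ) * I ≠ 0 := mul_ne_zero (neg_ne_zero.2 hS) Complex.I_ne_zero
  -- the matrix identity
  have hm : (((kV α β p : UForm α β) : GL (α ⊕ β) ℂ) : Matrix (α ⊕ β) (α ⊕ β) ℂ) *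
      (((hypV p₀ q₀ t : UForm α β) : GL (α ⊕ β) ℂ) : Matrix (α ⊕ β) (α ⊕ β) ℂ) =
      (((hypV p₀ q₀ t : UForm α β) : GL (α ⊕ β) ℂ) : Matrix (α ⊕ β) (α ⊕ β) ℂ) *
      (((kV α β q : UForm α β) : GL (α ⊕ β) ℂ) : Matrix (α ⊕ β) (α ⊕ β) ℂ) := by
    rw [← UForm.coe_mul, ← UForm.coe_mul, h]
  -- E1: column `p₀` of `P` is `θ e_{p₀}`
  have hE1 : ∀ a, (p.1 : Matrix α α ℂ) a p₀ = if a = p₀ then (q.2 : Matrix β β ℂ) q₀ q₀ else 0 := by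
    intro a
    have e := congrFun (congrFun hm (Sum.inl a)) (Sum.inr q₀)
    rw [coe_kV_mul_apply_inl, coe_mul_kV_apply_inr] at e
    simp only [hypV_inl_inr, and_true] at e
    rw [Finset.sum_eq_single p₀ (fun a'' _ ha'' => by rw [if_neg ha'', mul_zero])
      (fun h => absurd (Finset.mem_univ _) h), if_pos rfl] at e
    by_cases ha : a = p₀
    · rw [if_pos ha]
      rw [if_pos ha] at e
      exact mul_right_cancel₀ hSI' (e.trans (mul_comm _ _))
    · rw [if_neg ha]
      rw [if_neg ha, zero_mul] at e
      exact (mul_eq_zero.1 e).resolve_right hSI'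
  -- E2: row `p₀` of `Q` is `π e_{p₀}ᵀ`
  have hE2 : ∀ a', (q.1 : Matrix α α ℂ) p₀ a' = if a' = p₀ then (p.2 : Matrix β β ℂ) q₀ q₀ else 0 := by
    intro a'
    have e := congrFun (congrFun hm (Sum.inr q₀)) (Sum.inl a')
    rw [coe_kV_mul_apply_inr, coe_mul_kV_apply_inl] at e
    simp only [hypV_inr_inl, true_and] at e
    rw [Finset.sum_eq_single p₀ (fun a'' _ ha'' => by rw [if_neg ha'', zero_mul])
      (fun h => absurd (Finset.mem_univ _) h), if_pos rfl] at e
    by_cases ha' : a' = p₀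
    · rw [if_pos ha']
      rw [if_pos ha'] at e
      exact mul_left_cancel₀ hSI (e.symm.trans (mul_comm _ _))
    · rw [if_neg ha']
      rw [if_neg ha', mul_zero] at e
      exact (mul_eq_zero.1 e.symm).resolve_left hSI
  -- E3: `π = θ`
  have hE3 : (p.2 : Matrix β β ℂ) q₀ q₀ = (q.2 : Matrix β β ℂ) q₀ q₀ := by
    have e := congrFun (congrFun hm (Sum.inr q₀)) (Sum.inr q₀)
    rw [coe_kV_mul_apply_inr, coe_mul_kV_apply_inr] at e
    simp only [hypV_inr_inr, if_true] at e
    exact mul_right_cancel₀ hC (e.trans (mul_comm _ _))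
  -- the `(α, α)`-block sums, evaluated
  have hLsum : ∀ a a', ∑ a'', (p.1 : Matrix α α ℂ) a a'' *
      (if a'' = p₀ then (if a' = p₀ then (Real.cosh t : ℂ) else 0) else if a' = a'' then 1 else 0) =
      if a' = p₀ then (p.1 : Matrix α α ℂ) a p₀ * (Real.cosh t : ℂ) else (p.1 : Matrix α α ℂ) a a' := by
    intro a a'
    by_cases ha' : a' = p₀
    · subst ha'
      rw [if_pos rfl, Finset.sum_eq_single a' (fun x _ hx => by rw [if_neg hx, if_neg (Ne.symm hx), mul_zero])
        (fun h => absurd (Finset.mem_univ _) h), if_pos rfl, if_pos rfl]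
    · rw [if_neg ha', Finset.sum_eq_single a' (fun x _ hx => by
          by_cases hxp : x = p₀
          · simp [hxp]
          · simp [hxp, Ne.symm hx])
        (fun h => absurd (Finset.mem_univ _) h)]
      simp [ha']
  have hRsum : ∀ a a', ∑ a'', (if a = p₀ then (if a'' = p₀ then (Real.cosh t : ℂ) else 0) else if a'' = a then 1 else 0) *
      (q.1 : Matrix α α ℂ) a'' a' =
      if a = p₀ then (Real.cosh t : ℂ) * (q.1 : Matrix α α ℂ) p₀ a' else (q.1 : Matrix α α ℂ) a a' := by
    intro a a'
    by_cases ha : a = p₀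
    · subst ha
      rw [if_pos rfl, Finset.sum_eq_single a (fun x _ hx => by rw [if_pos rfl, if_neg hx, zero_mul])
        (fun h => absurd (Finset.mem_univ _) h), if_pos rfl, if_pos rfl]
    · rw [if_neg ha, Finset.sum_eq_single a (fun x _ hx => by rw [if_neg ha, if_neg hx, zero_mul])
        (fun h => absurd (Finset.mem_univ _) h), if_neg ha, if_pos rfl, one_mul]
  -- E4: `P = Q`
  have hE4 : (p.1 : Matrix α α ℂ) = (q.1 : Matrix α α ℂ) := by
    ext a a'
    have e := congrFun (congrFun hm (Sum.inl a)) (Sum.inl a')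
    rw [coe_kV_mul_apply_inl, coe_mul_kV_apply_inl] at e
    simp only [hypV_inl_inl] at e
    rw [hLsum, hRsum] at e
    by_cases ha : a = p₀ <;> by_cases ha' : a' = p₀
    · subst ha; subst ha'
      rw [hE1, hE2, if_pos rfl, if_pos rfl, hE3]
    · subst ha
      rw [if_neg ha', if_pos rfl, hE2, if_neg ha', mul_zero] at e
      rw [e, hE2, if_neg ha']
    · subst ha'
      rw [if_pos rfl, if_neg ha, hE1, if_neg ha, zero_mul] at e
      rw [hE1, if_neg ha, ← e]
    · rw [if_neg ha', if_neg ha] at e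
      exact e
  have hpq : p = q := by
    refine Prod.ext (Subtype.ext hE4) (Subtype.ext ?_)
    ext b b'
    rw [Subsingleton.elim b q₀, Subsingleton.elim b' q₀]
    exact hE3
  refine ⟨hpq, ?_⟩
  -- commutation with `H₀`, entry by entry
  ext i j
  rcases i with a | b <;> rcases j with a' | b'
  · rw [coe_kV_mul_apply_inl, coe_mul_kV_apply_inl]
    simp [boostUnit_inl_inl]
  · rw [coe_kV_mul_apply_inl, coe_mul_kV_apply_inr, Subsingleton.elim b' q₀]
    simp only [boostUnit_inl_inr, and_true]
    rw [Finset.sum_eq_single p₀ (fun a'' _ ha'' => by rw [if_neg ha'', mul_zero])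
      (fun h => absurd (Finset.mem_univ _) h), if_pos rfl, hE1, ← hE3]
    by_cases ha : a = p₀
    · rw [if_pos ha, if_pos ha]
      ring
    · rw [if_neg ha, if_neg ha, zero_mul, zero_mul]
  · rw [coe_kV_mul_apply_inr, coe_mul_kV_apply_inl, Subsingleton.elim b q₀]
    simp only [boostUnit_inr_inl, true_and]
    rw [Finset.sum_eq_single p₀ (fun a'' _ ha'' => by rw [if_neg ha'', zero_mul])
      (fun h => absurd (Finset.mem_univ _) h), if_pos rfl, hE4, hE2]
    by_cases ha' : a' = p₀
    · rw [if_pos ha', if_pos ha']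
      ring
    · rw [if_neg ha', if_neg ha', mul_zero, mul_zero]
  · rw [coe_kV_mul_apply_inr, coe_mul_kV_apply_inr]
    simp [boostUnit_inr_inr]

/-- **The fibre lemma, parameter part** (`|β| = 1`): `k₁ a_t k₂ = k₁' a_{t'} k₂'` with `t, t' ≥ 0` forces `t = t'` (the gauge `‖(·)_{q₀q₀}‖ = cosh`).
[cite: Knapp2002, Thm. 7.39] -/
theorem eq_of_kakMap_eq_of_nonneg [Subsingleton β] {k₁ k₂ k₁' k₂' : KV α β} {t t' : ℝ} (ht : 0 ≤ t) (ht' : 0 ≤ t')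
    (h : kakMap p₀ q₀ (k₁, t, k₂) = kakMap p₀ q₀ (k₁', t', k₂')) : t = t' := by
  have hg := congrArg (gauge q₀) h
  rw [gauge_kakMap, gauge_kakMap] at hg
  exact Real.cosh_strictMonoOn.injOn ht ht' hg

/-- **The fibre lemma, `K`-part** (`|β| = 1`, `t ≠ 0`): if `k₁ a_t k₂ = k₁' a_t k₂'` then with `m := k₁⁻¹ k₁'` one has `m = k₂ k₂'⁻¹` (so `k₁' = k₁ m`,
`k₂' = m⁻¹ k₂`) and `diag(m)` commutes with the boost generator `H₀`. [cite: Knapp2002, VII §3 (7.33), Thm. 7.39] -/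
theorem kakMap_fibre [Subsingleton β] {k₁ k₂ k₁' k₂' : KV α β} {t : ℝ} (ht : t ≠ 0)
    (h : kakMap p₀ q₀ (k₁, t, k₂) = kakMap p₀ q₀ (k₁', t, k₂')) :
    k₁⁻¹ * k₁' = k₂ * k₂'⁻¹ ∧
      (((kV α β (k₁⁻¹ * k₁') : UForm α β) : GL (α ⊕ β) ℂ) : Matrix (α ⊕ β) (α ⊕ β) ℂ) *
          ((upqUnit (p₀, q₀) (-I) : (uFormGroup α β).lie) : Matrix (α ⊕ β) (α ⊕ β) ℂ) =
        ((upqUnit (p₀, q₀) (-I) : (uFormGroup α β).lie) : Matrix (α ⊕ β) (α ⊕ β) ℂ) *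
          (((kV α β (k₁⁻¹ * k₁') : UForm α β) : GL (α ⊕ β) ℂ) : Matrix (α ⊕ β) (α ⊕ β) ℂ) := by
  have h' : kV α β (k₁⁻¹ * k₁') * hypV p₀ q₀ t = hypV p₀ q₀ t * kV α β (k₂ * k₂'⁻¹) := by
    rw [kakMap_apply, kakMap_apply] at h
    rw [map_mul, map_mul, map_inv, map_inv]
    calc (kV α β k₁)⁻¹ * kV α β k₁' * hypV p₀ q₀ t
        = (kV α β k₁)⁻¹ * (kV α β k₁' * hypV p₀ q₀ t * kV α β k₂') * (kV α β k₂')⁻¹ := by group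
      _ = (kV α β k₁)⁻¹ * (kV α β k₁ * hypV p₀ q₀ t * kV α β k₂) * (kV α β k₂')⁻¹ := by rw [h]
      _ = hypV p₀ q₀ t * (kV α β k₂ * (kV α β k₂')⁻¹) := by group
  exact eq_and_commute_of_kV_mul_hypV_eq p₀ q₀ ht h'

/-- `a_0 = 1`: over `t = 0` the fibre condition is just `k₁ k₂ = k₁' k₂'`. [cite: Knapp2002, I §1 Example (3), VII §3 Thm. 7.39] -/
theorem kakMap_zero_eq (k₁ k₂ : KV α β) : kakMap p₀ q₀ (k₁, 0, k₂) = kV α β (k₁ * k₂) := by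
  rw [kakMap_apply, hypV_zero, mul_one, map_mul]

end Fibre

/-! ## §3 `K` is transitive on the directions of `𝔭`: every hermitian `X ∈ 𝔲(α,β)` is `Ad k (c H₀)`, `c ≥ 0` -/

section Transitive

/-- A hermitian element of `𝔲(α, β)` is off-diagonal: `X = X_B = [[0, B], [Bᴴ, 0]]` with `B = X₁₂` (its diagonal blocks are skew-hermitian AND
hermitian). [cite: BorelWallach2000, II §1.1 (3)] -/
theorem coe_eq_fromBlocks_of_isHermitian (X : (uFormGroup α β).lie)
    (hX : ((X : Matrix (α ⊕ β) (α ⊕ β) ℂ))ᴴ = (X : Matrix (α ⊕ β) (α ⊕ β) ℂ)) :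
    (X : Matrix (α ⊕ β) (α ⊕ β) ℂ) =
      Matrix.fromBlocks 0 (X : Matrix (α ⊕ β) (α ⊕ β) ℂ).toBlocks₁₂ ((X : Matrix (α ⊕ β) (α ⊕ β) ℂ).toBlocks₁₂)ᴴ 0 := by
  obtain ⟨h11, h22, h21⟩ := upq_lie_blocks X
  set M : Matrix (α ⊕ β) (α ⊕ β) ℂ := (X : Matrix (α ⊕ β) (α ⊕ β) ℂ) with hM
  have hb := hX
  rw [← Matrix.fromBlocks_toBlocks M, Matrix.fromBlocks_conjTranspose, Matrix.fromBlocks_inj] at hb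
  obtain ⟨hA, -, -, hD⟩ := hb
  have hA0 : M.toBlocks₁₁ = 0 := by
    have h2 : M.toBlocks₁₁ = -M.toBlocks₁₁ := hA.symm.trans h11
    ext i j
    have hij := congrFun (congrFun h2 i) j
    rw [Matrix.neg_apply] at hij
    exact CharZero.eq_neg_self_iff.mp hij
  have hD0 : M.toBlocks₂₂ = 0 := by
    have h2 : M.toBlocks₂₂ = -M.toBlocks₂₂ := hD.symm.trans h22
    ext i j
    have hij := congrFun (congrFun h2 i) j
    rw [Matrix.neg_apply] at hij
    exact CharZero.eq_neg_self_iff.mp hij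
  conv_lhs => rw [← Matrix.fromBlocks_toBlocks M, hA0, hD0, h21]

/-- `c • H₀` is the off-diagonal element `X_{B₀}` with `B₀ = c · (−i) E_{p₀ q₀}`. [cite: Knapp2002, VI §2] -/
theorem smul_boostUnit_eq_offDiag (c : ℝ) :
    c • (upqUnit (p₀, q₀) (-I) : (uFormGroup α β).lie) =
      ⟨Matrix.fromBlocks 0 (Matrix.single p₀ q₀ (-(c : ℂ) * I)) (Matrix.single p₀ q₀ (-(c : ℂ) * I))ᴴ 0, upq_offDiag_mem_lie _⟩ := by
  apply Subtype.ext
  change c • ((upqUnit (p₀, q₀) (-I) : (uFormGroup α β).lie) : Matrix (α ⊕ β) (α ⊕ β) ℂ) =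
    Matrix.fromBlocks 0 (Matrix.single p₀ q₀ (-(c : ℂ) * I)) (Matrix.single p₀ q₀ (-(c : ℂ) * I))ᴴ 0
  ext i j
  rw [Matrix.smul_apply]
  rcases i with a | b <;> rcases j with a' | b'
  · rw [boostUnit_inl_inl, Matrix.fromBlocks_apply₁₁, Matrix.zero_apply, smul_zero]
  · rw [boostUnit_inl_inr, Matrix.fromBlocks_apply₁₂, Matrix.single_apply]
    by_cases h : a = p₀ ∧ b' = q₀
    · rw [if_pos h, if_pos ⟨h.1.symm, h.2.symm⟩, Complex.real_smul]
      ring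
    · rw [if_neg h, if_neg (fun h' => h ⟨h'.1.symm, h'.2.symm⟩), smul_zero]
  · rw [boostUnit_inr_inl, Matrix.fromBlocks_apply₂₁, Matrix.conjTranspose_apply, Matrix.single_apply]
    by_cases h : b = q₀ ∧ a' = p₀
    · rw [if_pos h, if_pos ⟨h.2.symm, h.1.symm⟩, Complex.real_smul, star_mul, star_neg]
      simp only [Complex.star_def, Complex.conj_ofReal, Complex.conj_I]
      ring
    · rw [if_neg h, if_neg (fun h' => h ⟨h'.2.symm, h'.1.symm⟩), smul_zero, star_zero]
  · rw [boostUnit_inr_inr, Matrix.fromBlocks_apply₂₂, Matrix.zero_apply, smul_zero]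

/-- **`K` is transitive on the directions of `𝔭`** (`|β| = 1`, real rank one): every hermitian `X ∈ 𝔲(α, β)` is `Ad(k) (c H₀)` for some
`k = diag(u, 1) ∈ K` and `c = ‖X₁₂‖ ≥ 0` (choose `u ∈ U(α)` with `u e_{p₀} = (i/c) X₁₂`, ★ `exists_unitaryGroup_col_eq`). [cite: Knapp2002, Thm. 6.51] -/
theorem exists_Ad_smul_boostUnit_eq_of_isHermitian [Subsingleton β] (X : (uFormGroup α β).lie)
    (hX : ((X : Matrix (α ⊕ β) (α ⊕ β) ℂ))ᴴ = (X : Matrix (α ⊕ β) (α ⊕ β) ℂ)) :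
    ∃ (u : Matrix.unitaryGroup α ℂ) (c : ℝ), 0 ≤ c ∧
      X = (uFormGroup α β).Ad (Subgroup.inclusion (uFormGroup α β).maximalCompact_le_carrier
        ⟨_, upq_kV_mem_maximalCompact u (1 : Matrix.unitaryGroup β ℂ)⟩) (c • upqUnit (p₀, q₀) (-I)) := by
  set B : Matrix α β ℂ := (X : Matrix (α ⊕ β) (α ⊕ β) ℂ).toBlocks₁₂ with hB
  have hXB : X = ⟨Matrix.fromBlocks 0 B Bᴴ 0, upq_offDiag_mem_lie B⟩ := Subtype.ext (coe_eq_fromBlocks_of_isHermitian X hX)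
  set c : ℝ := Real.sqrt (∑ a, ‖B a q₀‖ ^ 2) with hc
  have hsum : 0 ≤ ∑ a, ‖B a q₀‖ ^ 2 := Finset.sum_nonneg fun a _ => by positivity
  have hc0 : 0 ≤ c := Real.sqrt_nonneg _
  have hcsq : c ^ 2 = ∑ a, ‖B a q₀‖ ^ 2 := Real.sq_sqrt hsum
  by_cases hz : c = 0
  · -- then `B = 0` and `X = 0 = Ad 1 (0 • H₀)`
    have hB0 : B = 0 := by
      have hs : ∑ a, ‖B a q₀‖ ^ 2 = 0 := by rw [← hcsq, hz]; ring
      ext a b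
      rw [Subsingleton.elim b q₀, Matrix.zero_apply]
      have ha := (Finset.sum_eq_zero_iff_of_nonneg (fun a _ => by positivity)).1 hs a (Finset.mem_univ a)
      exact norm_eq_zero.1 (pow_eq_zero_iff two_ne_zero |>.1 ha)
    refine ⟨1, 0, le_rfl, ?_⟩
    rw [zero_smul, map_zero, hXB]
    apply Subtype.ext
    change Matrix.fromBlocks 0 B Bᴴ 0 = ((0 : (uFormGroup α β).lie) : Matrix (α ⊕ β) (α ⊕ β) ℂ)
    rw [hB0, Matrix.conjTranspose_zero, Matrix.fromBlocks_zero]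
    rfl
  · have hcpos : 0 < c := lt_of_le_of_ne hc0 (Ne.symm hz)
    have hcC : (c : ℂ) ≠ 0 := by exact_mod_cast hz
    -- the unit vector `w = (i/c) B_{·q₀}` is the `p₀`-column of a unitary `u`
    set w : α → ℂ := fun a => I / (c : ℂ) * B a q₀ with hw
    have hwn : ∑ a, ‖w a‖ ^ 2 = 1 := by
      have h1 : ∀ a, ‖w a‖ ^ 2 = ‖B a q₀‖ ^ 2 / c ^ 2 := fun a => by
        rw [hw]
        dsimp only
        rw [norm_mul, norm_div, Complex.norm_I, Complex.norm_real, Real.norm_eq_abs, abs_of_pos hcpos]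
        field_simp
      simp only [h1, ← Finset.sum_div, ← hcsq]
      exact div_self (pow_ne_zero 2 hz)
    obtain ⟨u, hu⟩ := exists_unitaryGroup_col_eq p₀ w hwn
    refine ⟨u, c, hc0, ?_⟩
    rw [smul_boostUnit_eq_offDiag, upq_Ad_kV_offDiag, hXB]
    -- `u · (−c i E_{p₀q₀}) · 1 = B`
    have hkey : (u : Matrix α α ℂ) * Matrix.single p₀ q₀ (-(c : ℂ) * I) * ((1 : Matrix.unitaryGroup β ℂ) : Matrix β β ℂ)ᴴ = B := by
      rw [OneMemClass.coe_one, Matrix.conjTranspose_one, Matrix.mul_one]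
      ext a b
      rw [Subsingleton.elim b q₀, Matrix.mul_apply, Finset.sum_eq_single p₀ (fun a' _ ha' => by
          rw [Matrix.single_apply, if_neg (fun h => ha' h.1.symm), mul_zero]) (fun h => absurd (Finset.mem_univ _) h),
        Matrix.single_apply_same, hu a, hw]
      dsimp only
      field_simp
      ring_nf
      rw [Complex.I_sq]
      ring
    simp only [hkey]

end Transitive

/-! ## §4 The curve `s ↦ g · a_s` meets `K` at most once -/

section BadPoints

/-- **`‖g_{q₀q₀}‖ ≥ 1` on `U(α,β)`** (`|β| = 1`): by the `(q₀, q₀)` entry of `gᴴ J g = J`, `‖g_{q₀q₀}‖² = 1 + Σ_a ‖g_{a q₀}‖²`. [cite: Knapp2002, I §1 Example (3), VII §3 Thm. 7.39] -/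
theorem one_le_gauge [Subsingleton β] (g : UForm α β) : 1 ≤ gauge q₀ g := by
  have e := UForm.form_apply g (Sum.inr q₀) (Sum.inr q₀)
  have hJ : signForm α β (Sum.inr q₀) (Sum.inr q₀) = -1 := by
    rw [signForm_eq_diagonal, Matrix.diagonal_apply_eq, Sum.elim_inr]
  rw [Fintype.sum_subsingleton _ q₀, hJ] at e
  have hsq : ‖(((g : UForm α β) : GL (α ⊕ β) ℂ) : Matrix (α ⊕ β) (α ⊕ β) ℂ) (Sum.inr q₀) (Sum.inr q₀)‖ ^ 2 =
      1 + ∑ a, ‖(((g : UForm α β) : GL (α ⊕ β) ℂ) : Matrix (α ⊕ β) (α ⊕ β) ℂ) (Sum.inl a) (Sum.inr q₀)‖ ^ 2 := by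
    have h1 : ∀ z : ℂ, star z * z = ((‖z‖ ^ 2 : ℝ) : ℂ) := fun z => by
      rw [Complex.star_def, Complex.conj_mul', Complex.ofReal_pow]
    simp only [h1] at e
    have e' : ((∑ a, ‖(((g : UForm α β) : GL (α ⊕ β) ℂ) : Matrix (α ⊕ β) (α ⊕ β) ℂ) (Sum.inl a) (Sum.inr q₀)‖ ^ 2 : ℝ) : ℂ) -
        ((‖(((g : UForm α β) : GL (α ⊕ β) ℂ) : Matrix (α ⊕ β) (α ⊕ β) ℂ) (Sum.inr q₀) (Sum.inr q₀)‖ ^ 2 : ℝ) : ℂ) = -1 := by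
      rw [Complex.ofReal_sum]; exact e
    have e'' := congrArg Complex.re e'
    simp only [Complex.sub_re, Complex.ofReal_re, Complex.neg_re, Complex.one_re] at e''
    linarith
  have hnn : 0 ≤ ∑ a, ‖(((g : UForm α β) : GL (α ⊕ β) ℂ) : Matrix (α ⊕ β) (α ⊕ β) ℂ) (Sum.inl a) (Sum.inr q₀)‖ ^ 2 :=
    Finset.sum_nonneg fun a _ => by positivity
  rw [gauge]
  nlinarith [norm_nonneg ((((g : UForm α β) : GL (α ⊕ β) ℂ) : Matrix (α ⊕ β) (α ⊕ β) ℂ) (Sum.inr q₀) (Sum.inr q₀))]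

/-- **Membership in `K` through the gauge** (`|β| = 1`): an element of `U(α,β)` with `‖g_{q₀q₀}‖ = 1` lies in `K = U(α) × U(β)` (its `q₀`-column is
`g_{q₀q₀} e_{q₀}`, and the stabiliser of `e_{q₀}` is `U(α) × 1`, ★ `exists_eq_kV_of_col_eq`). [cite: Knapp2002, Thm. 7.39] -/
theorem exists_kV_eq_of_gauge_eq_one [Subsingleton β] (g : UForm α β) (hg : gauge q₀ g = 1) : ∃ k : KV α β, g = kV α β k := by
  set M := (((g : UForm α β) : GL (α ⊕ β) ℂ) : Matrix (α ⊕ β) (α ⊕ β) ℂ) with hM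
  set z : ℂ := M (Sum.inr q₀) (Sum.inr q₀) with hz
  have hz1 : ‖z‖ = 1 := hg
  -- the rest of the `q₀`-column vanishes
  have e := UForm.form_apply g (Sum.inr q₀) (Sum.inr q₀)
  have hJ : signForm α β (Sum.inr q₀) (Sum.inr q₀) = -1 := by
    rw [signForm_eq_diagonal, Matrix.diagonal_apply_eq, Sum.elim_inr]
  rw [Fintype.sum_subsingleton _ q₀, hJ] at e
  have h1 : ∀ w : ℂ, star w * w = ((‖w‖ ^ 2 : ℝ) : ℂ) := fun w => by
    rw [Complex.star_def, Complex.conj_mul', Complex.ofReal_pow]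
  simp only [h1, ← hM, ← hz, hz1, one_pow, Complex.ofReal_one] at e
  have hcol0 : ∀ a, M (Sum.inl a) (Sum.inr q₀) = 0 := by
    have hs : ((∑ a, ‖M (Sum.inl a) (Sum.inr q₀)‖ ^ 2 : ℝ) : ℂ) = 0 := by
      rw [Complex.ofReal_sum]
      have := e
      linear_combination this
    have hs' : ∑ a, ‖M (Sum.inl a) (Sum.inr q₀)‖ ^ 2 = 0 := by exact_mod_cast hs
    intro a
    have ha := (Finset.sum_eq_zero_iff_of_nonneg (fun a _ => by positivity)).1 hs' a (Finset.mem_univ a)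
    exact norm_eq_zero.1 (pow_eq_zero_iff two_ne_zero |>.1 ha)
  -- divide by the unit scalar `z`: `g · diag(1, z̄)` fixes `e_{q₀}`
  have hzne : z ≠ 0 := fun h => by rw [h, norm_zero] at hz1; exact zero_ne_one hz1
  set d : Matrix.unitaryGroup β ℂ := unitaryScalar (star z) (by rw [norm_star, hz1]) with hd
  have hfix := exists_eq_kV_of_col_eq q₀ (g * kV α β (1, d)) (fun a => by
      rw [UForm.coe_mul, coe_mul_kV_apply_inr, ← hM, hcol0, zero_mul]) (by
      rw [UForm.coe_mul, coe_mul_kV_apply_inr, ← hM, ← hz]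
      change z * ((d : Matrix β β ℂ) q₀ q₀) = 1
      rw [hd, unitaryScalar_apply, Complex.star_def, Complex.mul_conj, Complex.normSq_eq_norm_sq, hz1, one_pow, Complex.ofReal_one])
  obtain ⟨u, hu⟩ := hfix
  refine ⟨(u, 1) * (1, d)⁻¹, ?_⟩
  rw [map_mul, map_inv, ← hu, mul_inv_cancel_right]

/-- The `(q₀, q₀)` entry along the curve `s ↦ g · a_s`: `(g a_s)_{q₀q₀} = g_{q₀p₀} · (−i sinh s) + g_{q₀q₀} · cosh s`. [cite: Knapp2002, I §1 Example (3), VII §3 Thm. 7.39] -/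
theorem mul_hypV_inr_inr [Subsingleton β] (g : UForm α β) (s : ℝ) :
    (((g * hypV p₀ q₀ s : UForm α β) : GL (α ⊕ β) ℂ) : Matrix (α ⊕ β) (α ⊕ β) ℂ) (Sum.inr q₀) (Sum.inr q₀) =
      (((g : UForm α β) : GL (α ⊕ β) ℂ) : Matrix (α ⊕ β) (α ⊕ β) ℂ) (Sum.inr q₀) (Sum.inl p₀) * (-(Real.sinh s : ℂ) * I) +
        (((g : UForm α β) : GL (α ⊕ β) ℂ) : Matrix (α ⊕ β) (α ⊕ β) ℂ) (Sum.inr q₀) (Sum.inr q₀) * (Real.cosh s : ℂ) := by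
  rw [UForm.coe_mul, Matrix.mul_apply, Fintype.sum_sum_type, Fintype.sum_subsingleton _ q₀]
  simp only [hypV_inl_inr, hypV_inr_inr, and_true, if_true]
  rw [Finset.sum_eq_single p₀ (fun a _ ha => by rw [if_neg ha, mul_zero]) (fun h => absurd (Finset.mem_univ _) h), if_pos rfl]

/-- **The squared gauge along `s ↦ g · a_s`** (`|β| = 1`): with `u = g_{q₀p₀}`, `v = g_{q₀q₀}`, `A = (v − iu)/2`, `B = (v + iu)/2`,
`‖(g a_s)_{q₀q₀}‖² = ‖A‖² e^{2s} + ‖B‖² e^{−2s} + 2 Re(A B̄)`. [cite: Knapp2002, I §1 Example (3), VII §3 Thm. 7.39] -/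
theorem gauge_mul_hypV_sq [Subsingleton β] (g : UForm α β) (s : ℝ) :
    gauge q₀ (g * hypV p₀ q₀ s) ^ 2 =
      Complex.normSq (((((g : UForm α β) : GL (α ⊕ β) ℂ) : Matrix (α ⊕ β) (α ⊕ β) ℂ) (Sum.inr q₀) (Sum.inr q₀) -
          I * (((g : UForm α β) : GL (α ⊕ β) ℂ) : Matrix (α ⊕ β) (α ⊕ β) ℂ) (Sum.inr q₀) (Sum.inl p₀)) / 2) * Real.exp (2 * s) +
        Complex.normSq (((((g : UForm α β) : GL (α ⊕ β) ℂ) : Matrix (α ⊕ β) (α ⊕ β) ℂ) (Sum.inr q₀) (Sum.inr q₀) +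
          I * (((g : UForm α β) : GL (α ⊕ β) ℂ) : Matrix (α ⊕ β) (α ⊕ β) ℂ) (Sum.inr q₀) (Sum.inl p₀)) / 2) * Real.exp (-(2 * s)) +
        2 * ((((((g : UForm α β) : GL (α ⊕ β) ℂ) : Matrix (α ⊕ β) (α ⊕ β) ℂ) (Sum.inr q₀) (Sum.inr q₀) -
          I * (((g : UForm α β) : GL (α ⊕ β) ℂ) : Matrix (α ⊕ β) (α ⊕ β) ℂ) (Sum.inr q₀) (Sum.inl p₀)) / 2) *
          (starRingEnd ℂ) (((((g : UForm α β) : GL (α ⊕ β) ℂ) : Matrix (α ⊕ β) (α ⊕ β) ℂ) (Sum.inr q₀) (Sum.inr q₀) +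
          I * (((g : UForm α β) : GL (α ⊕ β) ℂ) : Matrix (α ⊕ β) (α ⊕ β) ℂ) (Sum.inr q₀) (Sum.inl p₀)) / 2)).re := by
  set u : ℂ := (((g : UForm α β) : GL (α ⊕ β) ℂ) : Matrix (α ⊕ β) (α ⊕ β) ℂ) (Sum.inr q₀) (Sum.inl p₀) with hu
  set v : ℂ := (((g : UForm α β) : GL (α ⊕ β) ℂ) : Matrix (α ⊕ β) (α ⊕ β) ℂ) (Sum.inr q₀) (Sum.inr q₀) with hv
  set A : ℂ := (v - I * u) / 2 with hA
  set B : ℂ := (v + I * u) / 2 with hB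
  have hentry : (((g * hypV p₀ q₀ s : UForm α β) : GL (α ⊕ β) ℂ) : Matrix (α ⊕ β) (α ⊕ β) ℂ) (Sum.inr q₀) (Sum.inr q₀) =
      A * (Real.exp s : ℂ) + B * (Real.exp (-s) : ℂ) := by
    rw [mul_hypV_inr_inr, ← hu, ← hv, hA, hB, Real.sinh_eq, Real.cosh_eq]
    push_cast
    ring
  rw [gauge, hentry, ← Complex.normSq_eq_norm_sq, Complex.normSq_add, Complex.normSq_mul, Complex.normSq_mul, Complex.normSq_ofReal,
    Complex.normSq_ofReal, map_mul, Complex.conj_ofReal]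
  have h4 : (Real.exp s : ℂ) * (Real.exp (-s) : ℂ) = 1 := by
    rw [← Complex.ofReal_mul, ← Real.exp_add, add_neg_cancel, Real.exp_zero, Complex.ofReal_one]
  have hre : (A * (Real.exp s : ℂ) * ((starRingEnd ℂ) B * (Real.exp (-s) : ℂ))).re = (A * (starRingEnd ℂ) B).re := by
    rw [show A * (Real.exp s : ℂ) * ((starRingEnd ℂ) B * (Real.exp (-s) : ℂ)) = A * (starRingEnd ℂ) B * ((Real.exp s : ℂ) * (Real.exp (-s) : ℂ))
      by ring, h4, mul_one]
  rw [hre, show Real.exp s * Real.exp s = Real.exp (2 * s) by rw [two_mul, Real.exp_add],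
    show Real.exp (-s) * Real.exp (-s) = Real.exp (-(2 * s)) by rw [two_mul, neg_add, Real.exp_add]]

/-- **`2a e^{2s} − 2b e^{−2s}` vanishes at most once** for `a, b ≥ 0` not both zero. [cite: Knapp2002, I §1 Example (3), VII §3 Thm. 7.39] -/
theorem subsingleton_setOf_exp_balance {a b : ℝ} (ha : 0 ≤ a) (hb : 0 ≤ b) (hab : a ≠ 0 ∨ b ≠ 0) :
    Set.Subsingleton {s : ℝ | 2 * a * Real.exp (2 * s) - 2 * b * Real.exp (-(2 * s)) = 0} := by
  intro s hs s' hs'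
  simp only [Set.mem_setOf_eq, sub_eq_zero] at hs hs'
  by_cases ha0 : a = 0
  · exfalso
    have hb0 : b ≠ 0 := hab.resolve_left (not_not.2 ha0)
    have hbpos : 0 < b := lt_of_le_of_ne hb (Ne.symm hb0)
    rw [ha0] at hs
    have h0 : 2 * b * Real.exp (-(2 * s)) = 0 := by rw [← hs]; ring
    have hpos : 0 < 2 * b * Real.exp (-(2 * s)) := mul_pos (mul_pos two_pos hbpos) (Real.exp_pos _)
    linarith
  · have hapos : 0 < a := lt_of_le_of_ne ha (Ne.symm ha0)
    have key : ∀ x : ℝ, 2 * a * Real.exp (2 * x) = 2 * b * Real.exp (-(2 * x)) → Real.exp (4 * x) = b / a := by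
      intro x hx
      have hx' : a * (Real.exp (2 * x) * Real.exp (2 * x)) = b * (Real.exp (-(2 * x)) * Real.exp (2 * x)) := by
        linear_combination (Real.exp (2 * x) / 2) * hx
      rw [← Real.exp_add, ← Real.exp_add, neg_add_cancel, Real.exp_zero, mul_one] at hx'
      rw [eq_div_iff hapos.ne', show (4 : ℝ) * x = 2 * x + 2 * x by ring, mul_comm]
      exact hx'
    have h := (key s hs).trans (key s' hs').symm
    have h' := Real.exp_injective h
    linarith

/-- `kV k` has gauge one. [cite: Knapp2002, I §1 Example (3), VII §3 Thm. 7.39] -/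
theorem gauge_kV [Subsingleton β] (k : KV α β) : gauge q₀ (kV α β k) = 1 := by
  rw [gauge, UForm.coe_kV, Matrix.fromBlocks_apply₂₂]
  exact norm_entry_unitary_subsingleton k.2 q₀

/-- **The curve `s ↦ g · a_s` meets `K` at most once** (`|β| = 1`): the set of `s` with `g a_s ∈ K` is a subsingleton.  The squared gauge
`φ(s) = ‖A‖² e^{2s} + ‖B‖² e^{−2s} + 2 Re(A B̄)` (★ `gauge_mul_hypV_sq`; `A`, `B` not both zero since `‖g_{q₀q₀}‖ ≥ 1`) is `≥ 1` everywhere, so the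
points with `g a_s ∈ K` (`φ = 1`) are minima, hence zeros of `φ' = 2‖A‖²e^{2s} − 2‖B‖²e^{−2s}`, of which there is at most one. [cite: Knapp2002, Thm. 7.39] -/
theorem subsingleton_setOf_mul_hypV_mem_range_kV [Subsingleton β] (g : UForm α β) :
    Set.Subsingleton {s : ℝ | g * hypV p₀ q₀ s ∈ Set.range (kV α β)} := by
  set u : ℂ := (((g : UForm α β) : GL (α ⊕ β) ℂ) : Matrix (α ⊕ β) (α ⊕ β) ℂ) (Sum.inr q₀) (Sum.inl p₀) with hu
  set v : ℂ := (((g : UForm α β) : GL (α ⊕ β) ℂ) : Matrix (α ⊕ β) (α ⊕ β) ℂ) (Sum.inr q₀) (Sum.inr q₀) with hv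
  set A : ℂ := (v - I * u) / 2 with hA
  set B : ℂ := (v + I * u) / 2 with hB
  set a : ℝ := Complex.normSq A with ha
  set b : ℝ := Complex.normSq B with hb
  set φ : ℝ → ℝ := fun s => a * Real.exp (2 * s) + b * Real.exp (-(2 * s)) + 2 * (A * (starRingEnd ℂ) B).re with hφ
  have hgauge : ∀ s, gauge q₀ (g * hypV p₀ q₀ s) ^ 2 = φ s := fun s => gauge_mul_hypV_sq p₀ q₀ g s
  -- derivative of `φ`
  have hφ' : ∀ s, HasDerivAt φ (2 * a * Real.exp (2 * s) - 2 * b * Real.exp (-(2 * s))) s := by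
    intro s
    have h1 : HasDerivAt (fun s : ℝ => Real.exp (2 * s)) (Real.exp (2 * s) * 2) s := by
      have := ((hasDerivAt_id s).const_mul (2 : ℝ)).exp
      simpa using this
    have h2 : HasDerivAt (fun s : ℝ => Real.exp (-(2 * s))) (Real.exp (-(2 * s)) * (-2)) s := by
      have := ((hasDerivAt_id s).const_mul (2 : ℝ)).fun_neg.exp
      simpa using this
    have h := ((h1.const_mul a).add (h2.const_mul b)).add_const (2 * (A * (starRingEnd ℂ) B).re)
    exact h.congr_deriv (by ring)
  -- `A`, `B` are not both zero (`‖v‖ ≥ 1`)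
  have hv1 : 1 ≤ ‖v‖ := one_le_gauge q₀ g
  have hAB : a ≠ 0 ∨ b ≠ 0 := by
    by_contra hcon
    push Not at hcon
    have hA0 : A = 0 := Complex.normSq_eq_zero.1 hcon.1
    have hB0 : B = 0 := Complex.normSq_eq_zero.1 hcon.2
    have : v = A + B := by rw [hA, hB]; ring
    rw [hA0, hB0, add_zero] at this
    rw [this, norm_zero] at hv1
    exact absurd hv1 (by norm_num)
  -- the bad points are critical points of `φ`
  have hmin : ∀ x ∈ ({s : ℝ | g * hypV p₀ q₀ s ∈ Set.range (kV α β)} : Set ℝ), 2 * a * Real.exp (2 * x) - 2 * b * Real.exp (-(2 * x)) = 0 := by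
    intro x hx
    obtain ⟨k, hk⟩ := hx
    have hφx : φ x = 1 := by rw [← hgauge, ← hk, gauge_kV, one_pow]
    have hge : ∀ y, φ x ≤ φ y := fun y => by
      rw [hφx, ← hgauge]
      have := one_le_gauge q₀ (g * hypV p₀ q₀ y)
      nlinarith
    have hloc : IsLocalMin φ x := Filter.Eventually.of_forall hge
    exact hloc.hasDerivAt_eq_zero (hφ' x)
  intro s hs s' hs'
  exact subsingleton_setOf_exp_balance (Complex.normSq_nonneg _) (Complex.normSq_nonneg _) hAB (hmin s hs) (hmin s' hs')

end BadPoints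

end RealDualPair

end Literature.RepresentationTheory.KonnoKonno2007

end
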